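import Mathlib
import Literature.Topology.PlaneTopology.ArgumentIncrement
import Literature.Topology.PlaneTopology.WindingNumber
import Literature.Probability.RandomPlanarGeometry.LoopWinding
import Literature.Probability.RandomPlanarGeometry.LoopConfigurations
import HarnessLib

/-!
# Stub `stub_treeRigidity`: model loops — circle lobes with a retraced needle

Crux `Summit.CriticalPhenomena.CardyFormulaZ2.Theses.CardyMagicRigidity.NestingRigidity`
(stmt-CriticalPhenomena-4835), line `positive-cone-weight-doubling`, registered stub `stub_treeRigidity`.
Toolkit for the law-level route-gap witness `…TreeRigidityFamilySwitch` (family-by-family agreement of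
the pattern-count laws does NOT determine the law of the multiset of winding interiors): explicit
unbased loops of the plane with prescribed trace and winding FUNCTION, namely

* `exists_lobeLoop` — the circle of centre `c` through `P ≠ c` traversed once anticlockwise: trace
  `sphere c ‖P − c‖`, winding number `1` on the open disc and `0` elsewhere (everywhere, the trace
  included);
* `exists_needledLobeLoop` — the same circle followed by the NEEDLE `P → Q → P` along the segment
  `[P, Q]` and back: trace `sphere c ‖P − c‖ ∪ [P, Q]`, winding number `0` on the segment and on the
  circle, `1` on the rest of the open disc, `0` outside.  With `Q` inside the disc this is a loop whose
  winding interior is the SLIT disc `B(c, ρ) ∖ [P, Q]` and whose trace is exactly the frontier of that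
  interior: it passes every clause of `Regular` although it retraces an arc.

Ingredients (§§1–3): lobes and needles as Mathlib `Path P P` (so that they concatenate, `Path.trans`);
winding numbers of Mathlib loops read as tree curves (`Curve.ofPath`) add under concatenation
(`Path.argInc_trans`), a lobe winds once around its open disc (explicit logarithm at the centre, Rouché
inside, `Curve.wind_eq_zero_of_subset_ball` outside), and a needle winds around nothing
(`wind_comp_eq_zero_of_hasLogOn`: it factors through the segment, on which `w ↦ w − z` has a
continuous logarithm).  §§1 and 3 are adapted (general centre and base point) from the figure-eight
toolkit of `…RegularNotRigid` (p120899), whose lemmas are private.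
-/

noncomputable section

open Set Metric Complex
open scoped Real Topology

namespace Summit.CriticalPhenomena.CardyFormulaZ2.Cruxes.NestingRigidity.PositiveConeWeightDoubling

open Literature.Probability.RandomPlanarGeometry
open Literature.Topology.PlaneTopology (int_eq_of_mul_two_pi_I_eq)

namespace NeedleLoops

/-! ## §1 Circle lobes through a base point -/

/-- **Lobes.**  The circle of centre `c` through `P`, traversed once anticlockwise from `P` to `P`,
`t ↦ c + (P − c)·e^{2πit}`, as a Mathlib `Path P P`. -/
theorem exists_lobe (c P : ℂ) :
    ∃ γ : Path P P, ∀ t, γ t = c + (P - c) * exp (2 * π * (t : ℝ) * I) :=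
  ⟨{ toFun := fun t ↦ c + (P - c) * exp (2 * π * (t : ℝ) * I)
     continuous_toFun := by fun_prop
     source' := by simp
     target' := by
       simp only [Set.Icc.coe_one, ofReal_one, mul_one]
       rw [exp_two_pi_mul_I, mul_one, add_sub_cancel] }, fun _ ↦ rfl⟩

/-- A lobe stays at distance `‖P − c‖` from its centre. -/
theorem norm_lobe_sub_center {c P : ℂ} {γ : Path P P}
    (hγ : ∀ t, γ t = c + (P - c) * exp (2 * π * (t : ℝ) * I)) (t : unitInterval) : ‖γ t - c‖ = ‖P - c‖ := by
  rw [hγ t, add_sub_cancel_left, norm_mul,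
    show (2 * π * (t : ℝ) * I : ℂ) = ((2 * π * (t : ℝ) : ℝ) : ℂ) * I by push_cast; ring,
    norm_exp_ofReal_mul_I, mul_one]

/-- The trace of a lobe is the whole circle of centre `c` through `P`. -/
theorem range_lobe {c P : ℂ} (hP : P ≠ c) {γ : Path P P}
    (hγ : ∀ t, γ t = c + (P - c) * exp (2 * π * (t : ℝ) * I)) : range γ = sphere c ‖P - c‖ := by
  have ha : P - c ≠ 0 := sub_ne_zero.2 hP
  refine Subset.antisymm ?_ fun w hw ↦ ?_
  · rintro _ ⟨t, rfl⟩
    rw [mem_sphere, dist_eq_norm, norm_lobe_sub_center hγ]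
  · -- `(w - c)/(P - c)` is a unit complex number, hence `e^{iθ}` with `θ ∈ (0, 2π]`
    rw [mem_sphere, dist_eq_norm] at hw
    have hζ : (w - c) / (P - c) ∈ sphere (0 : ℂ) |(1 : ℝ)| := by
      rw [mem_sphere, dist_zero_right, norm_div, hw, div_self (norm_ne_zero_iff.2 ha), abs_one]
    rw [← image_circleMap_Ioc] at hζ
    obtain ⟨θ, hθ, hθζ⟩ := hζ
    simp only [circleMap, ofReal_one, one_mul, zero_add] at hθζ
    refine ⟨⟨θ / (2 * π), (div_pos hθ.1 Real.two_pi_pos).le, ?_⟩, ?_⟩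
    · rw [div_le_one Real.two_pi_pos]; exact hθ.2
    · have : (2 * π * ((θ / (2 * π) : ℝ) : ℂ) * I : ℂ) = θ * I := by push_cast; field_simp
      rw [hγ, Subtype.coe_mk, this, hθζ, mul_div_cancel₀ _ ha, add_sub_cancel]

/-! ## §2 Winding numbers of Mathlib loops: concatenation; lobes -/

/-- For a Mathlib loop `γ : Path x x` and `z ∉ γ`, the argument increment `Path.argInc γ z` is `2πi ×`
the tree's winding number of `Curve.ofPath γ`. -/
theorem argInc_eq_wind_ofPath_mul {x : ℂ} (γ : Path x x) {z : ℂ} (hz : z ∉ Set.range γ) :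
    γ.argInc z = (Curve.ofPath γ).wind z * (2 * π * I) := by
  rw [Path.argInc_eq_wind_mul γ hz, show (Curve.ofPath γ).wind z = Literature.Topology.PlaneTopology.wind
    (fun t ↦ γ.extend t - z) from Literature.Topology.PlaneTopology.wind_congr fun t ht ↦ by
      rw [Curve.subPt_of_mem _ z ht, Path.extend_apply γ ht, Curve.ofPath_apply]]

/-- A Mathlib loop read as a curve is a loop. -/
theorem isLoop_ofPath {x : ℂ} (γ : Path x x) : (Curve.ofPath γ).IsLoop := by
  rw [Curve.isLoop_iff, Curve.source_ofPath, Curve.target_ofPath]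

/-- **Winding numbers add under concatenation** of loops at one base point (`Path.argInc_trans`). -/
theorem wind_ofPath_trans {x : ℂ} (γ₁ γ₂ : Path x x) {z : ℂ} (h₁ : z ∉ Set.range γ₁)
    (h₂ : z ∉ Set.range γ₂) :
    (Curve.ofPath (γ₁.trans γ₂)).wind z = (Curve.ofPath γ₁).wind z + (Curve.ofPath γ₂).wind z := by
  have h : z ∉ Set.range (γ₁.trans γ₂) := by
    rw [Path.trans_range]
    rintro (h | h)
    exacts [h₁ h, h₂ h]
  have key := Path.argInc_trans γ₁ γ₂ h₁ h₂
  rw [argInc_eq_wind_ofPath_mul _ h, argInc_eq_wind_ofPath_mul _ h₁, argInc_eq_wind_ofPath_mul _ h₂,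
    ← add_mul] at key
  exact int_eq_of_mul_two_pi_I_eq (by push_cast; exact key)

/-- A lobe winds once around its centre (explicit logarithm `log(P − c) + 2πit` of `γ t − c`). -/
theorem wind_lobe_center {c P : ℂ} (hP : P ≠ c) {γ : Path P P}
    (hγ : ∀ t, γ t = c + (P - c) * exp (2 * π * (t : ℝ) * I)) : (Curve.ofPath γ).wind c = 1 :=
  Curve.wind_eq_of_log (isLoop_ofPath γ) (l := fun t ↦ log (P - c) + 2 * π * t * I) (by fun_prop)
    (fun t ht ↦ by rw [exp_add, exp_log (sub_ne_zero.2 hP), Curve.ofPath_apply, hγ, add_sub_cancel_left])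
    (by push_cast; ring)

/-- **Winding number of a lobe**, everywhere: the indicator of its open disc (inside: Rouché — moving
the centre by less than the radius keeps `W = 1`; outside: the trace lies in a ball missing the point;
on the circle: the junk value `0`). -/
theorem wind_lobe_eq_ite {c P : ℂ} (hP : P ≠ c) {γ : Path P P}
    (hγ : ∀ t, γ t = c + (P - c) * exp (2 * π * (t : ℝ) * I)) (z : ℂ) :
    (Curve.ofPath γ).wind z = if dist z c < ‖P - c‖ then 1 else 0 := by
  by_cases hz : dist z c = ‖P - c‖
  · rw [if_neg (by rw [hz]; exact lt_irrefl _)]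
    exact Curve.wind_of_mem_range (show z ∈ Set.range γ by rw [range_lobe hP hγ]; exact hz)
  split_ifs with h
  · rw [← wind_lobe_center hP hγ]
    have hloop := isLoop_ofPath γ
    have hρ : 0 < ‖P - c‖ := norm_pos_iff.2 (sub_ne_zero.2 hP)
    have hc : c ∉ (Curve.ofPath γ).range := by
      rw [show (Curve.ofPath γ).range = Set.range γ from rfl, range_lobe hP hγ, mem_sphere, dist_self]
      exact hρ.ne
    refine Literature.Topology.PlaneTopology.wind_eq_of_norm_sub_lt
      (Curve.continuous_subPt _ z).continuousOn (Curve.subPt_zero_eq_one hloop z)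
      (Curve.isNonvanishingLoop_subPt hloop hc) fun t ht ↦ ?_
    rw [Curve.subPt_of_mem _ _ ht, Curve.subPt_of_mem _ _ ht, sub_sub_sub_cancel_left,
      Curve.ofPath_apply, norm_lobe_sub_center hγ, ← dist_eq_norm, dist_comm]
    exact h
  · refine Curve.wind_eq_zero_of_subset_ball (w := c) (ρ := dist z c) ?_ le_rfl
    rintro _ ⟨t, rfl⟩
    rw [mem_ball, dist_eq_norm, Curve.ofPath_apply, norm_lobe_sub_center hγ]
    exact lt_of_le_of_ne (not_lt.1 h) (Ne.symm hz)

/-! ## §3 Needles: a segment traversed there and back -/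

/-- **Needles.**  The segment `[P, Q]` traversed from `P` to `Q` and back, `t ↦ P + (Q − P)(1 − |2t − 1|)`,
as a Mathlib `Path P P`. -/
theorem exists_needle (P Q : ℂ) :
    ∃ γ : Path P P, ∀ t, γ t = P + (Q - P) * ((1 - |2 * (t : ℝ) - 1| : ℝ) : ℂ) :=
  ⟨{ toFun := fun t ↦ P + (Q - P) * ((1 - |2 * (t : ℝ) - 1| : ℝ) : ℂ)
     continuous_toFun := by fun_prop
     source' := by norm_num
     target' := by norm_num }, fun _ ↦ rfl⟩

/-- The height `1 − |2t − 1|` of the needle lies in `[0, 1]` for `t ∈ [0, 1]`. -/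
theorem needleHeight_mem {t : ℝ} (ht : t ∈ Icc (0 : ℝ) 1) : 1 - |2 * t - 1| ∈ Icc (0 : ℝ) 1 := by
  constructor
  · have : |2 * t - 1| ≤ 1 := abs_le.2 ⟨by linarith [ht.1], by linarith [ht.2]⟩
    linarith
  · linarith [abs_nonneg (2 * t - 1)]

/-- The trace of a needle is the closed segment `[P, Q]`. -/
theorem range_needle {P Q : ℂ} {γ : Path P P}
    (hγ : ∀ t, γ t = P + (Q - P) * ((1 - |2 * (t : ℝ) - 1| : ℝ) : ℂ)) : range γ = segment ℝ P Q := by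
  rw [segment_eq_image']
  refine Subset.antisymm ?_ ?_
  · rintro _ ⟨t, rfl⟩
    refine ⟨1 - |2 * (t : ℝ) - 1|, needleHeight_mem t.2, ?_⟩
    simp only [hγ, Complex.real_smul, mul_comm]
  · rintro _ ⟨s, hs, rfl⟩
    refine ⟨⟨s / 2, by linarith [hs.1], by linarith [hs.2]⟩, ?_⟩
    have habs : 1 - |2 * (s / 2) - 1| = s := by
      rw [show 2 * (s / 2) - 1 = -(1 - s) by ring, abs_neg, abs_of_nonneg (by linarith [hs.2])]
      ring
    simp only [hγ, Complex.real_smul, habs, mul_comm]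

/-- **A needle winds around nothing**: `W = 0` everywhere (on the segment this is the junk value; off
it, `w ↦ w − z` has a continuous logarithm on the segment, through which the needle factors). -/
theorem wind_needle {P Q : ℂ} {γ : Path P P}
    (hγ : ∀ t, γ t = P + (Q - P) * ((1 - |2 * (t : ℝ) - 1| : ℝ) : ℂ)) (z : ℂ) :
    (Curve.ofPath γ).wind z = 0 := by
  by_cases hz : z ∈ segment ℝ P Q
  · exact Curve.wind_of_mem_range (show z ∈ Set.range γ by rwa [range_needle hγ])
  -- the straight parametrisation of the segment, minus `z`, has a logarithm on `[0, 1]`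
  set F : ℝ → ℂ := fun s ↦ P + (Q - P) * (s : ℂ) - z with hF
  have hFlog : Literature.Topology.PlaneTopology.HasLogOn F (Icc 0 1) := by
    refine Literature.Topology.PlaneTopology.hasLogOn_Icc (by fun_prop) fun s hs hs0 ↦ hz ?_
    rw [segment_eq_image']
    refine ⟨s, hs, ?_⟩
    have : P + (Q - P) * (s : ℂ) = z := sub_eq_zero.1 hs0
    simp only [Complex.real_smul, ← this, mul_comm]
  set g : ℝ → ℝ := fun t ↦ 1 - |2 * t - 1| with hg
  have key := Literature.Topology.PlaneTopology.wind_comp_eq_zero_of_hasLogOn (γ := g) hFlog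
    (by fun_prop) (fun t ht ↦ needleHeight_mem ht) (by norm_num [hg])
  rw [Curve.wind, ← key]
  refine Literature.Topology.PlaneTopology.wind_congr fun t ht ↦ ?_
  rw [Curve.subPt_of_mem _ z ht, Curve.ofPath_apply, hγ]
  simp [hF, hg]

end NeedleLoops

open NeedleLoops

/-! ## §4 The model loops as unbased loops: traces and winding functions -/

/-- **The lobe loop.**  For `P ≠ c` there is an unbased loop with trace the circle of centre `c`
through `P` and winding function the indicator of the open disc: `1` on `B(c, ‖P − c‖)`, `0` off it
(the circle included). -/
theorem exists_lobeLoop (c P : ℂ) (hP : P ≠ c) : ∃ u : UnbasedLoop ℂ,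
    u.range = sphere c ‖P - c‖ ∧ (∀ z, dist z c < ‖P - c‖ → u.wind z = 1) ∧
      ∀ z, ‖P - c‖ ≤ dist z c → u.wind z = 0 := by
  obtain ⟨γ, hγ⟩ := exists_lobe c P
  refine ⟨UnbasedLoop.mk (BasedLoop.mk (CurveClass.mk (Curve.ofPath γ))
    (CurveClass.isLoop_mk.2 (isLoop_ofPath _))), ?_, fun z hz ↦ ?_, fun z hz ↦ ?_⟩
  · exact (range_lobe hP hγ : Set.range γ = _)
  · change (Curve.ofPath γ).wind z = 1
    rw [wind_lobe_eq_ite hP hγ z, if_pos hz]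
  · change (Curve.ofPath γ).wind z = 0
    rw [wind_lobe_eq_ite hP hγ z, if_neg (not_lt.2 hz)]

/-- **The needled lobe loop (registered anchor of this toolkit).**  For `P ≠ c` and any `Q` there is an
unbased loop — the circle of centre `c` through `P` once anticlockwise, then the needle `P → Q → P` —
with trace `sphere c ‖P − c‖ ∪ [P, Q]` and winding function `0` on the segment `[P, Q]`, and off the
segment `1` on the open disc `B(c, ‖P − c‖)` and `0` elsewhere. -/
theorem exists_needledLobeLoop : ∀ (c P Q : ℂ), P ≠ c → ∃ u : UnbasedLoop ℂ,
    u.range = Metric.sphere c ‖P - c‖ ∪ segment ℝ P Q ∧ (∀ z ∈ segment ℝ P Q, u.wind z = 0) ∧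
      (∀ z, z ∉ segment ℝ P Q → dist z c < ‖P - c‖ → u.wind z = 1) ∧
      (∀ z, z ∉ segment ℝ P Q → ‖P - c‖ ≤ dist z c → u.wind z = 0) := by
  intro c P Q hP
  obtain ⟨γ₁, hγ₁⟩ := exists_lobe c P
  obtain ⟨γ₂, hγ₂⟩ := exists_needle P Q
  have h₁r : Set.range γ₁ = sphere c ‖P - c‖ := range_lobe hP hγ₁
  have h₂r : Set.range γ₂ = segment ℝ P Q := range_needle hγ₂
  set u : UnbasedLoop ℂ := UnbasedLoop.mk (BasedLoop.mk (CurveClass.mk (Curve.ofPath (γ₁.trans γ₂)))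
    (CurveClass.isLoop_mk.2 (isLoop_ofPath _))) with hu
  have hur : u.range = sphere c ‖P - c‖ ∪ segment ℝ P Q := by
    rw [← h₁r, ← h₂r, ← Path.trans_range]; rfl
  -- off the segment, the winding number is that of the lobe
  have hoff : ∀ z, z ∉ segment ℝ P Q → u.wind z = if dist z c < ‖P - c‖ then 1 else 0 := by
    intro z hzs
    by_cases hzc : dist z c = ‖P - c‖
    · rw [if_neg (by rw [hzc]; exact lt_irrefl _)]
      exact Curve.wind_of_mem_range (show z ∈ Set.range (γ₁.trans γ₂) by
        rw [Path.trans_range, h₁r]; exact Or.inl hzc)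
    change (Curve.ofPath (γ₁.trans γ₂)).wind z = _
    rw [wind_ofPath_trans _ _ (by rwa [h₁r]) (by rwa [h₂r]), wind_lobe_eq_ite hP hγ₁, wind_needle hγ₂,
      add_zero]
  refine ⟨u, hur, fun z hzs ↦ ?_, fun z hzs hz ↦ by rw [hoff z hzs, if_pos hz],
    fun z hzs hz ↦ by rw [hoff z hzs, if_neg (not_lt.2 hz)]⟩
  exact Curve.wind_of_mem_range (show z ∈ Set.range (γ₁.trans γ₂) by
    rw [Path.trans_range, h₂r]; exact Or.inr hzs)

end Summit.CriticalPhenomena.CardyFormulaZ2.Cruxes.NestingRigidity.PositiveConeWeightDoubling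

end
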